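import Summits.AtomisticToContinuum.HydrodynamicLimit.Theses.JParityClosure
import Literature.MathematicalPhysics.KineticTheory.RegularStationaryState
import Literature.MathematicalPhysics.KineticTheory.HardSphereFluxIntensities

/-!
# Line `rate-sandwich-isolated-maxwellians` for crux `JParityClosure.OddContactSymmetry`
(item stmt-AtomisticToContinuum-13078; crux-plan, round 1; idea card
`Cruxes/OddContactSymmetry/Ideas/rate-sandwich-isolated-maxwellians.md`, triage TRIAGE-r1-1: pass)

Skeleton: five registered stubs `stub_*` (sorried) and the kernel-checked composition
`OddContactSymmetry_of : OddContactSymmetry` (no `sorry` of its own; it invokes the five stubs through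
the sorry-free stationary-level composition `exists_stationaryOddSymmetry`). Local skeleton audit
(`#h21_check_skeleton`): ok, theorem = `OddContactSymmetry_of`, 5 stubs, closed = false (stubs open).

THE LINE (entropy squeeze + isolation, run on STATIONARY local limits). Every local limit of the
Euler-scaled torus gas around a space-time point where the reduced density is `< η₀` is (a mixture of
spatially ergodic) regular stationary translation-invariant states `ν` of the infinite hard-sphere flow
at unit diameter (`RegularStationaryState`, `IsSpatiallyErgodic`; density = reduced density `φ`).
For such states (`InClass`):

* Stub N1 `stub_rateSandwich` — the parity-FREE dynamical input: the directed-contact statistics of `ν`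
  are sandwiched around the Stosszahlansatz prediction built from `ν`'s own one-body velocity law,
  `|κ_ν(Ξ) − φ²⟨Ξ B⟩_{π_ν⊗π_ν}| ≤ C₁ φ · φ²⟨Ξ (1 + √θ/|v−w|) B⟩` (the `|g|`-weighted two-sided O(φ)
  rate bound asked for by triage sharpening (1); `Y(φ) − 1 = O(φ)` is absorbed in `C₁`).
* Stub SQ `stub_entropySqueeze` — squeeze + Cercignani-type stability: velocity balance of a stationary
  state gives `∫κ_ν F = 0` exactly (`F` the surprisal jump), the J-substitution turns it into
  `4 D_B(h_ν) ≤ C₁ φ ∫ B (1 + √θ/|g|)(hh_* + h′h′_*)|F|` (triage Check.lean `squeeze_pointwise`), and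
  entropy-production stability on the a-priori class puts `h_ν` inside any prescribed entropy basin
  `H(π_ν | M_ν) ≤ h₀` once `φ < φ₄(C₁, h₀)`: far-from-equilibrium ⇒ near-equilibrium, parity-free.
* Stub N4 `stub_oddResponse` — THE PARITY CONTENT (relocated, not discharged — triage sharpening (2)):
  inside a basin `H ≤ h₁`, the J-odd directed-contact statistics of a regular ergodic stationary dilute
  state respond Lipschitz-continuously to its one-body deviation, `|κ_ν(Ψ)| ≤ K √θ φ² √H(π_ν | M_ν)`
  for every bounded continuous J-odd mark `Ψ`; at `H = 0` this is "Maxwellian marginal ⇒ J-even contact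
  law" (equilibrium case: the reversing symmetry `R̂ : (x,v) ↦ (−x,v)` of Gibbs states, card
  `pt-shadow-flux-detailed-balance`).
* Stub IFT `stub_isolation` — Maxwellians are ISOLATED zeros of the stationarity equation: hard-sphere
  spectral gap (`hardSphereLinearizedOp_spectralGap`, discharged in tree) + the quadratic remainder +
  the forcing `−2M·marg(B M_* γ_a)` controlled by Stub N4 give `gap·‖δ‖ ≤ C‖δ‖² + φ(C₁C + 2K)‖δ‖`, so
  inside the basin and below `φ₂(C₁, K)` the deviation `δ` vanishes: `H(π_ν | M_ν) = 0`.
* Stub E `stub_localLimitReduction` — the transfer `C⁺ ⇒ crux`: if every such state below density `φ₀`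
  has Maxwellian velocity law and J-invariant directed-contact statistics
  (`StationaryOddSymmetryAt φ₀`), then the crux's body holds for some threshold `η₀ > 0` (local limits
  of the `(1 + e^{−F})`-reweighted odd statistic: `F̄ = 0` on the collision manifold of a Maxwellian,
  so the statistic tends to `2 κ̄(Ψ) = 0`; Young-measure / `r → 0` bookkeeping of the crux-attack
  report).

Composition (pure logic, `exists_stationaryOddSymmetry`): N1 ⇒ `C₁, φ₁`; N4 at basin `1` ⇒ `K, φ₃`;
IFT at `(C₁, K)` ⇒ `h₀, φ₂`; SQ at `(C₁, min h₀ 1)` ⇒ `φ₄`; `φ₀ := min (min φ₁ φ₂) (min φ₃ φ₄)`;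
for a state of the class below `φ₀`: sandwich, basin, odd response, `H = 0`, and N4 at `H = 0` gives
J-invariance; Stub E turns `StationaryOddSymmetryAt φ₀` into the crux (by name, `OddContactSymmetry_of`).

The abbreviations of §1 are TRANSPARENT one-line functionals of tree objects (`windowContacts`,
`InfiniteHardSphereFlow.traj`, `reflectVel`, `PointConfig.countKernel`, `PointProcess.density`,
`localMaxwellian`, `InformationTheory.klDiv`, `hardSphereKernel`, `sphereMeasure`); no new notion is
posited. Conventions: unit diameter (OVY blow-up at the scale of the sphere diameter, `blowUp`, so
density = reduced density); velocities right-continuous, so the incoming pair of a directed contact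
`(p, q, t)` is `reflectVel (x_p − x_q) (v_p(t), v_q(t))` and marks are read at `(n̂, v_p⁻, v_q⁻)`,
`n̂ = x_p(t) − x_q(t)`, exactly as the crux reads `Ψ (ε⁻¹(x_i − x_j), v_i⁻, v_j⁻)`;
`hardSphereKernel (w, v) n̂ = ((w − v)·n̂)₊ > 0` iff the pair is incoming. All one-body parameters
(`velMean`, `velTemp`) are moments of the velocity law `velLaw ν` itself (no Bochner junk from window
functionals); hard-sphere dynamics has no velocity scale, whence the explicit `√θ` factors.

Disproof used: none exists for this crux (no `Disproof.lean` published as of 2026-08-16; dead lines: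
none). Negatives index (`ledger negatives`): no parity / contact / stationary-state statement among the
refuted items; nothing here restates one.
-/

noncomputable section

open scoped BigOperators Topology ENNReal NNReal InnerProductSpace ProbabilityTheory
open MeasureTheory Set Filter Function
open Literature.Analysis.FunctionSpaces Literature.Analysis.FluidPDE
open Literature.MathematicalPhysics.KineticTheory

namespace Summit.AtomisticToContinuum.HydrodynamicLimit.Cruxes.OddContactSymmetry.RateSandwichIsolatedMaxwellians

/-! ## 1. Transparent abbreviations (directed-contact statistics of a law of the infinite gas) -/

/-- Pre-collisional data `(n̂, v_p⁻, v_q⁻)` of a directed contact `c = (p, q, t)` of the paths `x`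
(unit diameter, right-continuous velocities: the incoming pair is `reflectVel n̂` of the outgoing one,
`reflectVel n̂` being an involution). -/
def preData (x : V3 × V3 → ℝ → V3 × V3) (c : (V3 × V3) × (V3 × V3) × ℝ) : V3 × V3 × V3 :=
  ((x c.1 c.2.2).1 - (x c.2.1 c.2.2).1,
    (reflectVel ((x c.1 c.2.2).1 - (x c.2.1 c.2.2).1) ((x c.1 c.2.2).2, (x c.2.1 c.2.2).2)).1,
    (reflectVel ((x c.1 c.2.2).1 - (x c.2.1 c.2.2).1) ((x c.1 c.2.2).2, (x c.2.1 c.2.2).2)).2)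

/-- Sum of the mark `m (n̂, v⁻, w⁻)` over the directed contacts of the labelled paths `x p`, `p ∈ S`,
in the space-time window `[0,1)³ × [0,1)` (`windowContacts`, finite along hard-sphere trajectories). -/
def contactSum (S : Set (V3 × V3)) (x : V3 × V3 → ℝ → V3 × V3) (m : V3 × V3 × V3 → ℝ) : ℝ :=
  ∑ᶠ c ∈ windowContacts 1 S x, m (preData x c)

/-- The DIRECTED-CONTACT STATISTIC `κ_ν(m)`: mean of `contactSum` under the law `ν` along the flow
`Φ` — marks per unit volume per unit time (Bochner; an honest mean under `ContactRegular`). -/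
def contactMean (Φ : InfiniteHardSphereFlow (Fin 3) 1) (ν : Measure (PointConfig (V3 × V3)))
    (m : V3 × V3 × V3 → ℝ) : ℝ :=
  ∫ ω, contactSum (ω : Set (V3 × V3)) (Φ.traj ω) m ∂ν

/-- The ONE-BODY VELOCITY LAW `π_ν` of `ν` (Palm mark law): the velocity intensity of the particles
with position in the unit cube, read off the Campbell measure `ν ⊗ₘ countKernel` and normalised by the
density (a probability law when `0 < density ν < ∞`). -/
def velLaw (ν : Measure (PointConfig (V3 × V3))) : Measure V3 :=
  (PointProcess.density ν)⁻¹ •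
    (((ν ⊗ₘ PointConfig.countKernel).restrict {q | q.2.1 ∈ Torus.unitCube (Fin 3)}).map
      fun q => q.2.2)

/-- Mean velocity of the one-body velocity law. -/
def velMean (ν : Measure (PointConfig (V3 × V3))) : V3 :=
  ∫ v, v ∂velLaw ν

/-- Kinetic temperature of the one-body velocity law: `θ = ⅓ ∫ |v − u|² dπ_ν`. -/
def velTemp (ν : Measure (PointConfig (V3 × V3))) : ℝ :=
  (∫ v, ‖v - velMean ν‖ ^ 2 ∂velLaw ν) / 3

/-- The ONE-BODY DEVIATION `H(π_ν | M_ν)`: relative entropy of the velocity law to the Maxwellian with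
the same drift and temperature (`= 0` iff the velocity law IS that Maxwellian). -/
def velKL (ν : Measure (PointConfig (V3 × V3))) : ℝ≥0∞ :=
  InformationTheory.klDiv (velLaw ν)
    (volume.withDensity fun v => ENNReal.ofReal (localMaxwellian 1 (velTemp ν) (velMean ν) v))

/-- The STOSSZAHLANSATZ PREDICTION for the directed-contact statistic of a mark `Ξ`: rate
`φ² Ξ(n̂, v, w) ((w − v)·n̂)₊ dn̂ π_ν(dv) π_ν(dw)` (`φ` = density, unit diameter). -/
def chaosRate (ν : Measure (PointConfig (V3 × V3))) (Ξ : V3 × V3 × V3 → ℝ) : ℝ :=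
  (PointProcess.density ν).toReal ^ 2 *
    ∫ v, ∫ w, ∫ ω : Metric.sphere (0 : V3) 1,
      Ξ ((ω : V3), v, w) * hardSphereKernel (w, v) ω ∂sphereMeasure ∂velLaw ν ∂velLaw ν

/-- Admissible J-ODD MARKS: continuous, `|Ψ| ≤ 1`, odd under the inverse collision
`J (n̂, v, w) = (−n̂, v′, w′)` — the crux's parity clause verbatim (bound normalised to `1`). -/
def IsOddMark (Ψ : V3 × V3 × V3 → ℝ) : Prop :=
  Continuous Ψ ∧ (∀ q, |Ψ q| ≤ 1) ∧
    ∀ n v w : V3, ‖n‖ = 1 → Ψ (-n, (reflectVel n (v, w)).1, (reflectVel n (v, w)).2) = -Ψ (n, v, w)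

/-- CONTACT REGULARITY: bounded continuous marks have `ν`-integrable contact sums (finite
directed-contact intensity and measurability of the tracked orbit functionals under `ν`). -/
def ContactRegular (Φ : InfiniteHardSphereFlow (Fin 3) 1) (ν : Measure (PointConfig (V3 × V3))) :
    Prop :=
  ∀ m : V3 × V3 × V3 → ℝ, Continuous m → (∀ q, |m q| ≤ 1) →
    Integrable (fun ω : PointConfig (V3 × V3) => contactSum (ω : Set (V3 × V3)) (Φ.traj ω) m) ν

/-- THE CLASS: spatially ergodic regular stationary states of the infinite flow `Φ` (unit diameter)
with positive density and temperature, finite one-body deviation and contact regularity — the shape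
of the ergodic components of local limits that Stub E must establish. -/
def InClass (Φ : InfiniteHardSphereFlow (Fin 3) 1) (ν : Measure (PointConfig (V3 × V3))) : Prop :=
  RegularStationaryState Φ ν ∧ IsSpatiallyErgodic ν ∧ ContactRegular Φ ν ∧
    0 < PointProcess.density ν ∧ 0 < velTemp ν ∧ velKL ν ≠ ∞

/-- RATE SANDWICH with constant `C₁` (the `|g|`-weighted two-sided O(φ) bound on pre-collisional
dynamical correlations, in event form): for every continuous mark `0 ≤ Ξ ≤ 1`,
`|κ_ν(Ξ) − chaos(Ξ)| ≤ C₁ φ · chaos(Ξ · (1 + √θ/|v − w|))`. -/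
def RateSandwich (C₁ : ℝ) (Φ : InfiniteHardSphereFlow (Fin 3) 1)
    (ν : Measure (PointConfig (V3 × V3))) : Prop :=
  ∀ Ξ : V3 × V3 × V3 → ℝ, Continuous Ξ → (∀ q, 0 ≤ Ξ q) → (∀ q, Ξ q ≤ 1) →
    |contactMean Φ ν Ξ - chaosRate ν Ξ| ≤
      C₁ * (PointProcess.density ν).toReal *
        chaosRate ν (fun q => Ξ q * (1 + Real.sqrt (velTemp ν) / ‖q.2.1 - q.2.2‖))

/-- ODD RESPONSE with constant `K`: every admissible J-odd mark has directed-contact statistic bounded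
by `K √θ φ² √H(π_ν | M_ν)` (Lipschitz response of the J-odd contact correlation to the one-body
deviation; forces J-invariance at a Maxwellian velocity law). -/
def OddResponse (K : ℝ) (Φ : InfiniteHardSphereFlow (Fin 3) 1)
    (ν : Measure (PointConfig (V3 × V3))) : Prop :=
  ∀ Ψ, IsOddMark Ψ →
    |contactMean Φ ν Ψ| ≤
      K * Real.sqrt (velTemp ν) * (PointProcess.density ν).toReal ^ 2 *
        Real.sqrt (velKL ν).toReal

/-- J-INVARIANCE of the directed-contact statistics (untwisted detailed balance `κ_ν ∘ J = κ_ν`):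
every admissible J-odd mark has vanishing statistic. -/
def ContactJInvariant (Φ : InfiniteHardSphereFlow (Fin 3) 1)
    (ν : Measure (PointConfig (V3 × V3))) : Prop :=
  ∀ Ψ, IsOddMark Ψ → contactMean Φ ν Ψ = 0

/-- `C⁺` at threshold `φ₀` — STATIONARY ODD SYMMETRY: every state of the class with density `< φ₀`
has exactly Maxwellian one-body velocity law and J-invariant directed-contact statistics. -/
def StationaryOddSymmetryAt (φ₀ : ℝ) : Prop :=
  ∀ (Φ : InfiniteHardSphereFlow (Fin 3) 1) (ν : Measure (PointConfig (V3 × V3))),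
    InClass Φ ν → (PointProcess.density ν).toReal < φ₀ → velKL ν = 0 ∧ ContactJInvariant Φ ν

/-- The crux WITH ITS THRESHOLD MADE EXPLICIT, `OddContactSymmetry ↔ ∃ η₀ > 0, OddContactSymmetryAt η₀`
(body = the route decl's, verbatim; present only so that Stub E can name the threshold it delivers —
the composition re-folds it into the crux by name). -/
def OddContactSymmetryAt (η₀ : ℝ) : Prop :=
  ∀ (a₀ θ₀ : Literature.MathematicalPhysics.KineticTheory.T3 → ℝ) (u₀ : Literature.MathematicalPhysics.KineticTheory.T3 → Literature.MathematicalPhysics.KineticTheory.V3), Continuous a₀ → Continuous θ₀ → Continuous u₀ → (∀ x, 0 < a₀ x) → (∀ x, 0 < θ₀ x) → ∃ σ₀ : ℝ, 0 < σ₀ ∧ ∀ σ : ℝ, 0 < σ → σ < σ₀ → ∀ Φ : (N : ℕ) → Literature.Analysis.FluidPDE.HardSphereFlow (Literature.Analysis.FluidPDE.Torus.geometry (Fin 3)) (Literature.MathematicalPhysics.KineticTheory.hsDiameter σ N) (N + 1), ∀ τ : ℝ, 0 < τ → ∀ χ : ℝ × UnitAddTorus (Fin 3) → ℝ, Continuous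 χ → ∀ g : ℝ → ℝ, Continuous g → (∀ a, η₀ ≤ a → g a = 0) → ∀ Ψ : EuclideanSpace ℝ (Fin 3) × EuclideanSpace ℝ (Fin 3) × EuclideanSpace ℝ (Fin 3) → ℝ, Continuous Ψ → (∃ C : ℝ, ∀ q, |Ψ q| ≤ C) → (∀ (n v w : EuclideanSpace ℝ (Fin 3)), ‖n‖ = 1 → Ψ (-n, (Literature.Analysis.FluidPDE.reflectVel n (v, w)).1, (Literature.Analysis.FluidPDE.reflectVel n (v, w)).2) = -Ψ (n, v, w)) → ∀ η δ : ℝ, 0 < η → 0 < δ → ∃ r₀ : ℝ, 0 < r₀ ∧ ∀ r ϑ : ℝ, 0 < r → r < r₀ → 0 < ϑ → ϑ < r₀ → ∃ N₀ : ℕ, ∀ N : ℕ, N₀ ≤ N → let ε := Literature.MathematicalPhysics.KineticTheory.hsDiameter σ N; let G := Literature.Analysis.FluidPDE.Torus.geometry (Fin 3); let γ := fun z (s : ℝ) => (Φ N).flow s z; let bx : UnitAddTorus (Fin 3) → UnitAddTorus (Fin 3) → ℝ := fun x y => 3 / (Real.pi * r ^ 3) * max (1 - Literature.Analysis.FluidPDE.Torus.euclidDist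 x y / r) 0; let ρm := fun z s (x₀ : UnitAddTorus (Fin 3)) => ∫ q, bx q.1 x₀ ∂(Literature.Analysis.FluidPDE.empiricalMeasure (γ z s)); let hm := fun z s (x₀ : UnitAddTorus (Fin 3)) (v : EuclideanSpace ℝ (Fin 3)) => ∫ q, bx q.1 x₀ * Literature.Analysis.FluidPDE.localMaxwellian 1 (ϑ ^ 2) v q.2 ∂(Literature.Analysis.FluidPDE.empiricalMeasure (γ z s)); let pv := fun z s (i j : Fin (N + 1)) => Literature.Analysis.FluidPDE.reflectVel (G.sepVec (γ z s i).1 (γ z s j).1) ((γ z s i).2, (γ z s j).2); let F := fun z s (i j : Fin (N + 1)) => Real.log (hm z s (γ z s i).1 (pv z s i j).1) + Real.log (hm z s (γ z s i).1 (pv z s i j).2) - Real.log (hm z s (γ z s i).1 (γ z s i).2) - Real.log (hm z s (γ z s i).1 (γ z s j).2); let Kc := fun (Fn : Literature.Analysis.FluidPDE.Config (N + 1) (Fin 3) Literature.MathematicalPhysics.KineticTheory.T3 → ℝ → Fin (N + 1) → Fin (N + 1) → ℝ) z => ε / (N + 1 : ℝ) * ∑ᶠ (s : ℝ) (_ : s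 ∈ Literature.Analysis.FluidPDE.collisionTimes G ε (γ z) ∩ Set.Icc 0 τ), ∑ i : Fin (N + 1), ∑ j : Fin (N + 1), (if i ≠ j ∧ ‖G.sepVec (γ z s i).1 (γ z s j).1‖ = ε then Fn z s i j else 0); let D := fun z => Kc (fun z s i j => χ (s, (γ z s i).1) * g (σ ^ 3 * ρm z s (γ z s i).1) * (Ψ (ε⁻¹ • G.sepVec (γ z s i).1 (γ z s j).1, (pv z s i j).1, (pv z s i j).2) * (1 + Real.exp (-F z s i j)))) z; Literature.MathematicalPhysics.KineticTheory.localGibbsLaw σ a₀ u₀ θ₀ N (Φ N) {z | η < |D z|} ≤ ENNReal.ofReal δ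

/-! ## 2. The registered stubs -/

/-- **Stub N1 — rate sandwich (the parity-free dynamical bet).** There are `C₁` and `φ₁ > 0` such
that every state of the class (spatially ergodic regular stationary state of an infinite hard-sphere
flow at unit diameter, contact-regular, `θ > 0`, `H < ∞`) of density `φ < φ₁` satisfies the
`|g|`-weighted two-sided rate bound `RateSandwich C₁`: pre-collisional DYNAMICAL correlations of a
dilute stationary state are `O(φ)` uniformly in the impact geometry, whatever their parity and however
far the state is from equilibrium, up to the screening weight `1 + √θ/|v − w|` for slow pairs (triage
sharpening (1): a pair closing at `|g| ≲ φ v_th` is hit by a third body during its last diameter with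
probability `O(1)`). Why plausibly true: for the Gibbs state it holds with rate factor
`Y(φ) = 1 + (5π/12)φ + O(φ²)` and NO velocity correlation; in general it is a statement about the last
`O(log 1/φ)` mean free paths of the collision history of a pair in a state that does not evolve
(Lanford-window collision-history analysis — GST2013, BodineauEtAl2019, Denlinger2018 — with clustering
of the stationary state in place of long-time control), outside the recorded scope (A) of
`NoDensityExpansionBarrierNarrow`. Why it might fail: an O(1) pre-collisional correlation sustained by
a non-equilibrium stationary structure at arbitrarily small density. [size XL] -/
theorem stub_rateSandwich :
    ∃ C₁ : ℝ, ∃ φ₁ : ℝ, 0 < φ₁ ∧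
      ∀ (Φ : InfiniteHardSphereFlow (Fin 3) 1) (ν : Measure (PointConfig (V3 × V3))),
        InClass Φ ν → (PointProcess.density ν).toReal < φ₁ → RateSandwich C₁ Φ ν := by
  sorry

/-- **Stub SQ — entropy squeeze + stability (far-from-equilibrium ⇒ inside the basin).** For every
sandwich constant `C₁` and basin size `h₀ > 0` there is `φ₄ > 0` such that every state of the class of
density `φ < φ₄` obeying `RateSandwich C₁` has one-body deviation `H(π_ν | M_ν) ≤ h₀`.
Intended proof: (i) velocity balance of a stationary translation-invariant state (infinite-volume
Bogolyubov/Enskog identity, the stationary sibling of `EmpiricalEnskogIdentity`):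
`κ_ν(c(v⁺) − c(v⁻)) = 0`, with `c = log h_ν` after truncation: `∫κ_ν F = 0`; (ii) J-substitution
(`measurePreserving_swap_negDir`, `hardSphereKernel_swap_neg`) and the pointwise inequality
`squeeze_pointwise` (triage Check.lean): `4·entropyProduction B h_ν ≤ C₁ φ ∫ B (1 + √θ/|g|)
(hh_* + h′h′_*)|F|` — BOLTZMANN's production of the one-body law of the state is `O(φ)`; (iii) a-priori
class bounds DERIVED from stationarity under the two-sided kernel bounds (Povzner moments,
Pulvirenti–Wennberg Maxwellian lower bound, gain-term regularity) bound the right side after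
normalising `θ = 1`, and Villani's `D_B(h) ≥ K_ε H(h|M^h)^{1+ε}` (Villani 2003; Toscani–Villani 1999)
gives `H ≤ (C φ)^{1/(1+ε)} ≤ h₀`. The threshold must be uniform over the class (the crux's
`∃ η₀ ∀ profiles` forces it). Why it might fail: the a-priori bounds in (iii) are not uniform over the
class (thin, spiky stationary laws with small `D_B/∫B(hh_*+h′h′_*)|F|`). [size L] -/
theorem stub_entropySqueeze :
    ∀ C₁ : ℝ, ∀ h₀ : ℝ, 0 < h₀ → ∃ φ₄ : ℝ, 0 < φ₄ ∧
      ∀ (Φ : InfiniteHardSphereFlow (Fin 3) 1) (ν : Measure (PointConfig (V3 × V3))),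
        InClass Φ ν → (PointProcess.density ν).toReal < φ₄ → RateSandwich C₁ Φ ν →
          velKL ν ≤ ENNReal.ofReal h₀ := by
  sorry

/-- **Stub N4 — local odd response (the relocated parity content; hardest).** For every basin size
`h₁ > 0` there are `K` and `φ₃ > 0` such that for every state of the class of density `φ < φ₃` inside
the basin `H(π_ν | M_ν) ≤ h₁` and every admissible J-odd mark `Ψ`: `|κ_ν(Ψ)| ≤ K √θ φ² √H(π_ν | M_ν)`.
Content: writing `κ_ν = φ² γ B h h_*`, the odd statistic is
`½ φ² ∫Ψ B [γ_a (hh_* + h′h′_*) + γ_s (hh_* − h′h′_*)]`; the second bracket is one-body (weighted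
Csiszár–Kullback–Pinsker, `≲ √H + H`), the first is the J-ODD CONTACT CORRELATION, which must be
Lipschitz in the one-body deviation with `γ_a = 0` AT a Maxwellian law: for the Gibbs state this is
the reversing symmetry `R̂ = P∘T` whose contact trace is `J` (card pt-shadow-flux-detailed-balance,
triage §A); to first order in `φ` it is the J-odd projection of the zero-frequency ring operator
(route item 14620 `FirstOrderOddResponse`, VanbeijerenErnst1973; Dorfman–van Beijeren–Kirkpatrick
2021) — whether that projection is bounded at small `|g|` is the cheapest falsifier. Why it might fail:
a near-Maxwellian regular stationary dilute state carrying an odd contact correlation not controlled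
by its one-body deviation (the crux surplus "Maxwellian marginal ⇒ J-even contacts" on stationary
limits is the `H = 0` case). [size XL / open] -/
theorem stub_oddResponse :
    ∀ h₁ : ℝ, 0 < h₁ → ∃ K : ℝ, ∃ φ₃ : ℝ, 0 < φ₃ ∧
      ∀ (Φ : InfiniteHardSphereFlow (Fin 3) 1) (ν : Measure (PointConfig (V3 × V3))),
        InClass Φ ν → (PointProcess.density ν).toReal < φ₃ → velKL ν ≤ ENNReal.ofReal h₁ →
          OddResponse K Φ ν := by
  sorry

/-- **Stub IFT — isolation of Maxwellians.** For all constants `C₁, K` there are a basin `h₀ > 0` and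
a threshold `φ₂ > 0` such that a state of the class of density `φ < φ₂` that is sandwiched
(`RateSandwich C₁`), has odd response `K` and lies in the basin `H(π_ν | M_ν) ≤ h₀` has EXACTLY
Maxwellian velocity law, `H = 0`. Intended proof: with `h = M(1 + δ)`, `M = M_ν` (same five moments,
so `δ ⊥` collision invariants), stationarity (velocity balance) reads
`M·L_γδ = −Q_{γB}(Mδ, Mδ) − 2M·marg(B M_* γ_a)` with `L_γ` the linearised operator of the
`γ_s`-RESCALED kernel (J-even correlations do not drop out, they rescale `L`; its gap persists under
the two-sided bounds of the sandwich — triage sharpening (4)); the hard-sphere spectral gap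
(`hardSphereLinearizedOp_spectralGap`, `_holds` in tree; run in Mouhot's `L¹(m⁻¹)` setting,
Mouhot 2006, Gualdani–Mischler–Mouhot), `‖Q(δ,δ)‖ ≤ C‖δ‖²`, and the forcing bounded through the odd
response by `K φ ‖δ‖`, give `gap·‖δ‖ ≤ C‖δ‖² + φ (C₁ C + 2K) ‖δ‖`; in the basin (`‖δ‖` small via
Csiszár–Kullback + interpolation against the stationary moments) and for `φ < φ₂` this forces `δ = 0`.
Why it might fail: the norm bridge — the odd-response hypothesis controls the forcing only in an
unweighted (total-variation) currency, the gap lives in weighted spaces. [size L] -/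
theorem stub_isolation :
    ∀ C₁ K : ℝ, ∃ h₀ : ℝ, 0 < h₀ ∧ ∃ φ₂ : ℝ, 0 < φ₂ ∧
      ∀ (Φ : InfiniteHardSphereFlow (Fin 3) 1) (ν : Measure (PointConfig (V3 × V3))),
        InClass Φ ν → (PointProcess.density ν).toReal < φ₂ → RateSandwich C₁ Φ ν →
          OddResponse K Φ ν → velKL ν ≤ ENNReal.ofReal h₀ → velKL ν = 0 := by
  sorry

/-- **Stub E — local-limit reduction (the transfer `C⁺ ⇒ crux`).** If every state of the class below
density `φ₀` has Maxwellian velocity law and J-invariant directed-contact statistics, then the crux's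
body holds with some threshold `η₀ > 0` (intended `η₀ = φ₀`). Intended proof (XL bookkeeping, no new
mechanism): per profiles and `σ` small, (i) tightness of the blown-up space-time local laws (`blowUp`
at the scale of the sphere diameter; `CollisionTightness`, energy conservation) and their limits
`ν_{s,x}`: translation invariant, stationary (time averaging, OVY 1993 §4 Lemma 4.1), entropy-regular
(the relative entropy w.r.t. the Gibbs law is CONSERVED by the deterministic flow and is `≤ C N` at
`t = 0`), of finite density and energy, carried by Alexander-regular configurations so that an infinite
flow is a.e. defined and stationary for them (Alexander 1976, Thm 5.3 uniqueness class),
contact-regular (finite contact intensity from collision-count tightness), `θ > 0` and `H < ∞` from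
regularity; (ii) ergodic decomposition into members of `InClass` of density `< φ₀` wherever the cutoff
`g(σ³ρ_r)` is active (the crux's own "dense pockets" hazard lives HERE: components denser than the
`r`-ball average); (iii) identification of the `N → ∞` limit of `K_N[χ g Ψ (1 + e^{−F})]` at fixed
`(r, ϑ)` with `∫∫ χ g ⟨Ψ (1 + e^{−F_{r,ϑ}})⟩_{κ̄}` and the `r, ϑ → 0` passage (Lebesgue points; the
residual `T₂(r)` of the crux-attack report), where `velKL = 0` makes `F̄ = 0` on the collision manifold
and `ContactJInvariant` kills `2κ̄(Ψ)` (general bounded `Ψ` by rescaling to `|Ψ| ≤ 1`);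
(iv) in-probability form via Young measures over the randomness of the limit. Honours the crux-attack
read-back (pre-collisional `pv`, `∃ r₀` before `N₀`). Why it might fail: a deterministic local
ergodic decomposition with the listed regularity is itself unproved bookkeeping for hard spheres.
[size XL] -/
theorem stub_localLimitReduction :
    ∀ φ₀ : ℝ, 0 < φ₀ → StationaryOddSymmetryAt φ₀ → ∃ η₀ : ℝ, 0 < η₀ ∧ OddContactSymmetryAt η₀ := by
  sorry

/-! ## 3. Composition (sorry-free) -/

/-- The four stationary-level stubs give `C⁺`: stationary odd symmetry below a positive density
threshold (pure bookkeeping of thresholds and constants). -/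
theorem exists_stationaryOddSymmetry : ∃ φ₀ : ℝ, 0 < φ₀ ∧ StationaryOddSymmetryAt φ₀ := by
  obtain ⟨C₁, φ₁, hφ₁, hRS⟩ := stub_rateSandwich
  obtain ⟨K, φ₃, hφ₃, hOR⟩ := stub_oddResponse 1 one_pos
  obtain ⟨h₀, hh₀, φ₂, hφ₂, hIso⟩ := stub_isolation C₁ K
  obtain ⟨φ₄, hφ₄, hSq⟩ := stub_entropySqueeze C₁ (min h₀ 1) (lt_min hh₀ one_pos)
  refine ⟨min (min φ₁ φ₂) (min φ₃ φ₄), lt_min (lt_min hφ₁ hφ₂) (lt_min hφ₃ hφ₄), ?_⟩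
  intro Φ ν hcl hφ
  have h₁ : (PointProcess.density ν).toReal < φ₁ :=
    lt_of_lt_of_le hφ ((min_le_left _ _).trans (min_le_left _ _))
  have h₂ : (PointProcess.density ν).toReal < φ₂ :=
    lt_of_lt_of_le hφ ((min_le_left _ _).trans (min_le_right _ _))
  have h₃ : (PointProcess.density ν).toReal < φ₃ :=
    lt_of_lt_of_le hφ ((min_le_right _ _).trans (min_le_left _ _))
  have h₄ : (PointProcess.density ν).toReal < φ₄ :=
    lt_of_lt_of_le hφ ((min_le_right _ _).trans (min_le_right _ _))
  have hrs : RateSandwich C₁ Φ ν := hRS Φ ν hcl h₁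
  have hbasin : velKL ν ≤ ENNReal.ofReal (min h₀ 1) := hSq Φ ν hcl h₄ hrs
  have hb₀ : velKL ν ≤ ENNReal.ofReal h₀ :=
    hbasin.trans (ENNReal.ofReal_le_ofReal (min_le_left _ _))
  have hb₁ : velKL ν ≤ ENNReal.ofReal 1 :=
    hbasin.trans (ENNReal.ofReal_le_ofReal (min_le_right _ _))
  have hor : OddResponse K Φ ν := hOR Φ ν hcl h₃ hb₁
  have hzero : velKL ν = 0 := hIso Φ ν hcl h₂ hrs hor hb₀
  refine ⟨hzero, ?_⟩
  intro Ψ hΨ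
  have hb := hor Ψ hΨ
  rw [hzero, ENNReal.toReal_zero, Real.sqrt_zero, mul_zero] at hb
  exact abs_nonpos_iff.mp hb

/-- **Composition.** The five stubs imply the crux `JParityClosure.OddContactSymmetry`, concluded BY
NAME (kernel-checked; the only `sorry`s are inside the five stubs it invokes): `C⁺` from the
stationary-level stubs (`exists_stationaryOddSymmetry`), then the local-limit reduction (Stub E)
delivers a threshold `η₀` for which the crux's body holds, and the body is re-folded into the decl. -/
theorem OddContactSymmetry_of :
    Summit.AtomisticToContinuum.HydrodynamicLimit.Theses.JParityClosure.OddContactSymmetry := by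
  obtain ⟨φ₀, hφ₀, hstat⟩ := exists_stationaryOddSymmetry
  obtain ⟨η₀, hη₀, h⟩ := stub_localLimitReduction φ₀ hφ₀ hstat
  unfold OddContactSymmetryAt at h
  unfold Summit.AtomisticToContinuum.HydrodynamicLimit.Theses.JParityClosure.OddContactSymmetry
  exact ⟨η₀, hη₀, h⟩

end Summit.AtomisticToContinuum.HydrodynamicLimit.Cruxes.OddContactSymmetry.RateSandwichIsolatedMaxwellians
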